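import Mathlib
import Summits.CriticalPhenomena.CardyFormulaZ2.Theorems.CardyFlipRussoSquareFromVoronoiHubDefs
import Summits.CriticalPhenomena.CardyFormulaZ2.Theorems.CardyFlipRussoSquareFromVoronoiHubFaithfulPart1
import Summits.CriticalPhenomena.CardyFormulaZ2.Theorems.CardyFlipRussoSquareFromVoronoiHubFaithfulPart8
import Summits.CriticalPhenomena.CardyFormulaZ2.Theorems.CardyFlipRussoSquareFromVoronoiHubChessboardDefs
import HarnessLib

/-!
# Stub `stub_tiling` of line `Sketch` (r2 k4, card `poissonised-chessboard`), crux `SquareFromVoronoiHub`: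
# geometry of the cut-corner `4.8.8` block partition

Crux `Summit.CriticalPhenomena.CardyFormulaZ2.Theses.CardyFlipRusso.SquareFromVoronoiHub`
(stmt-CriticalPhenomena-6434), line `Sketch` (round 2, card `poissonised-chessboard`); registered
helper sub-goal `stub_tiling`.  The line's Defs module (`…ChessboardDefs`) partitions the plane at unit
mesh into BLOCKS `blkUnit x` indexed by the sites of the centred square lattice `G_s` (`zGs`, `Gs`):
the `ℓ¹`-diamonds of radius `1/4` about the face centres `ℤ² + (½,½)` (`Sum.inr`) and the
complementary cut-corner unit squares ("octagons") about the points of `ℤ²` (`Sum.inl`, sup-norm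
rounding) — the truncated square tiling `4.8.8`, dual to the tetrakis square tiling whose 1-skeleton
is `G_s`.  This file proves the three deterministic metric facts of this partition consumed (through an
abstract block map) by the chessboard-endpoint stubs of the skeleton, at mesh `δ > 0` via
`p ↦ blkUnit (p / δ)`:

* (RAD) `dist_zGs_blkUnit_le`: every point is within `3/5` (at mesh `δ`: `3δ/5`) of the centre of its
  block (diamond: circumradius `1/4`; octagon: `√5/4 < 3/5`);
* (SEP) `blkUnit_eq_or_adj`: two points at distance `≤ 1/4` lie in equal or `G_s`-adjacent blocks (two
  diamonds are `≥ 1/2` apart; a point within `1/4` of a diamond rounds to a corner of that face; two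
  octagons sharing only a vertex of `ℤ² + (½,½)` are separated there by the diamond);
* (SPINE) `blkUnit_convexComb`: the segment between the centres of two equal or adjacent blocks stays
  inside these two blocks (corner–corner edges run along the axes, far from the diamonds; a
  corner–centre half-diagonal enters the diamond at parameter `3/4`).

The key bookkeeping identity is `abs_fract_sub_half`: `|fract x - 1/2| = 1/2 - |x - round x|`, so the
diamond test `|fract re - 1/2| + |fract im - 1/2| ≤ 1/4` reads `|re - round re| + |im - round im| ≥ 3/4`.
All boundary conventions are those of the `if`, `⌊·⌋` and `round` in `blkUnit`.  Sources: the card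
`Cruxes/SquareFromVoronoiHub/Ideas/poissonised-chessboard.md`; Grünbaum–Shephard, *Tilings and
Patterns* (1987) §2.1 (the Archimedean tiling `4.8.8`); Bollobás–Riordan, *Percolation* (2006), Ch. 8
§8.2 (discretisations of Voronoi percolation).  Elementary; all statements are folklore.
-/

noncomputable section

open scoped Topology
open Filter Set Metric
open Summit.CriticalPhenomena.CardyFormulaZ2.Cruxes.SquareFromVoronoiHub.VoronoiBlocks (zGs Gs)
open Summit.CriticalPhenomena.CardyFormulaZ2.Cruxes.SquareFromVoronoiHub.VoronoiBlocks.Faithful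

namespace Summit.CriticalPhenomena.CardyFormulaZ2.Cruxes.SquareFromVoronoiHub.PoissonisedChessboard

/-! ### One-dimensional rounding facts -/

/-- The diamond test in terms of the distance to the nearest integer:
`|fract x - 1/2| = 1/2 - |x - round x|`. [folklore] -/
theorem abs_fract_sub_half (x : ℝ) : |Int.fract x - 1 / 2| = 1 / 2 - |x - round x| := by
  rw [abs_sub_round_eq_min]
  have h0 := Int.fract_nonneg x
  have h1 := Int.fract_lt_one x
  rcases le_total (Int.fract x) (1 / 2) with h | h
  · rw [min_eq_left (by linarith), abs_of_nonpos (by linarith)]; ring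
  · rw [min_eq_right (by linarith), abs_of_nonneg (by linarith)]; ring

/-- A convex combination `(1 - b) j + b k` of two integers at distance `≤ 1` rounds to one of
them. [folklore] -/
theorem round_convexComb {j k : ℤ} (hjk : |j - k| ≤ 1) {b : ℝ} (hb0 : 0 ≤ b) (hb1 : b ≤ 1) :
    round ((1 - b) * j + b * k : ℝ) = j ∨ round ((1 - b) * j + b * k : ℝ) = k := by
  rcases Int.abs_le_one_iff.1 hjk with h | h | h
  · obtain rfl : j = k := sub_eq_zero.1 h
    left; rw [round_eq_iff]; constructor <;> nlinarith
  · obtain rfl : j = k + 1 := by omega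
    push_cast
    rcases le_or_gt b (1 / 2) with hb | hb
    · left; rw [round_eq_iff]; push_cast; constructor <;> nlinarith
    · right; rw [round_eq_iff]; constructor <;> nlinarith
  · obtain rfl : j = k - 1 := by omega
    push_cast
    rcases lt_or_ge b (1 / 2) with hb | hb
    · left; rw [round_eq_iff]; push_cast; constructor <;> nlinarith
    · right; rw [round_eq_iff]; constructor <;> nlinarith

/-- Two reals at distance `≤ 1/4`, each within `1/4` of the half-integer above its floor, have the
same floor. [folklore] -/
theorem floor_eq_floor_of_abs_sub_le {x x' : ℝ} (hx : |x - x'| ≤ 1 / 4)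
    (hd : |Int.fract x - 1 / 2| ≤ 1 / 4) (hd' : |Int.fract x' - 1 / 2| ≤ 1 / 4) : ⌊x⌋ = ⌊x'⌋ := by
  rw [← Int.self_sub_floor] at hd hd'
  obtain ⟨h1, h2⟩ := abs_le.1 hx
  obtain ⟨h3, h4⟩ := abs_le.1 hd
  obtain ⟨h5, h6⟩ := abs_le.1 hd'
  have i1 : ⌊x⌋ - ⌊x'⌋ < 1 := by exact_mod_cast (show ((⌊x⌋ : ℤ) : ℝ) - ⌊x'⌋ < 1 by linarith)
  have i2 : ⌊x'⌋ - ⌊x⌋ < 1 := by exact_mod_cast (show ((⌊x'⌋ : ℤ) : ℝ) - ⌊x⌋ < 1 by linarith)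
  omega

/-- If `x` is within `1/4` of a point `x'` that is within `1/4` of the half-integer above its
floor, then `round x` is `⌊x'⌋` or `⌊x'⌋ + 1`. [folklore] -/
theorem round_sub_floor_of_abs_sub_le {x x' : ℝ} (hx : |x - x'| ≤ 1 / 4)
    (hd' : |Int.fract x' - 1 / 2| ≤ 1 / 4) : round x - ⌊x'⌋ = 0 ∨ round x - ⌊x'⌋ = 1 := by
  rw [← Int.self_sub_floor] at hd'
  obtain ⟨h1, h2⟩ := abs_le.1 hx
  obtain ⟨h3, h4⟩ := abs_le.1 hd'
  obtain ⟨h5, h6⟩ := abs_le.1 (abs_sub_round x)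
  have i1 : round x - ⌊x'⌋ < 2 := by exact_mod_cast (show ((round x : ℤ) : ℝ) - ⌊x'⌋ < 2 by linarith)
  have i2 : -1 < round x - ⌊x'⌋ := by exact_mod_cast (show (-1 : ℝ) < (round x : ℤ) - ⌊x'⌋ by linarith)
  omega

/-- Two integers with `|d| + |e| < 2` are both zero or form a unit vector. [folklore] -/
theorem int_eq_zero_or_sq_add_sq_eq_one {d e : ℤ} (h : |(d : ℝ)| + |(e : ℝ)| < 2) :
    (d = 0 ∧ e = 0) ∨ d ^ 2 + e ^ 2 = 1 := by
  have h1 := le_abs_self (d : ℝ)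
  have h2 := neg_le_abs (d : ℝ)
  have h3 := le_abs_self (e : ℝ)
  have h4 := neg_le_abs (e : ℝ)
  have i1 : d + e < 2 := by exact_mod_cast (show (d : ℝ) + e < 2 by linarith)
  have i2 : d - e < 2 := by exact_mod_cast (show (d : ℝ) - e < 2 by linarith)
  have i3 : -d + e < 2 := by exact_mod_cast (show -(d : ℝ) + e < 2 by linarith)
  have i4 : -d - e < 2 := by exact_mod_cast (show -(d : ℝ) - e < 2 by linarith)
  have hd1 : -1 ≤ d := by omega
  have hd2 : d ≤ 1 := by omega
  have he1 : -1 ≤ e := by omega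
  have he2 : e ≤ 1 := by omega
  interval_cases d <;> interval_cases e <;> omega

/-! ### The two kinds of blocks -/

/-- Sufficient condition for the OCTAGON block `inl p`: sup-distance `< 1/2` and `ℓ¹`-distance
`< 3/4` from the lattice point `p`. [folklore] -/
theorem blkUnit_eq_inl_of {w : ℂ} {p : ℤ × ℤ} (h1 : |w.re - p.1| < 1 / 2) (h2 : |w.im - p.2| < 1 / 2)
    (h3 : |w.re - p.1| + |w.im - p.2| < 3 / 4) : blkUnit w = Sum.inl p := by
  obtain ⟨h1a, h1b⟩ := abs_lt.1 h1
  obtain ⟨h2a, h2b⟩ := abs_lt.1 h2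
  have hr : round w.re = p.1 := round_eq_iff.2 ⟨by linarith, by linarith⟩
  have hi : round w.im = p.2 := round_eq_iff.2 ⟨by linarith, by linarith⟩
  have ht : ¬ (|Int.fract w.re - 1 / 2| + |Int.fract w.im - 1 / 2| ≤ 1 / 4) := by
    rw [abs_fract_sub_half, abs_fract_sub_half, hr, hi]; linarith
  rw [blkUnit, if_neg ht, hr, hi]

/-- Sufficient condition for the DIAMOND block `inr f`: `ℓ¹`-distance `≤ 1/4` from the face
centre `f + (½, ½)`. [folklore] -/
theorem blkUnit_eq_inr_of {w : ℂ} {f : ℤ × ℤ}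
    (h : |w.re - (f.1 + 1 / 2)| + |w.im - (f.2 + 1 / 2)| ≤ 1 / 4) : blkUnit w = Sum.inr f := by
  have ha := abs_nonneg (w.re - (f.1 + 1 / 2))
  have hb := abs_nonneg (w.im - (f.2 + 1 / 2))
  obtain ⟨h1a, h1b⟩ := abs_le.1 (show |w.re - (f.1 + 1 / 2)| ≤ 1 / 4 by linarith)
  obtain ⟨h2a, h2b⟩ := abs_le.1 (show |w.im - (f.2 + 1 / 2)| ≤ 1 / 4 by linarith)
  have hr : ⌊w.re⌋ = f.1 := Int.floor_eq_iff.2 ⟨by linarith, by linarith⟩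
  have hi : ⌊w.im⌋ = f.2 := Int.floor_eq_iff.2 ⟨by linarith, by linarith⟩
  have ht : |Int.fract w.re - 1 / 2| + |Int.fract w.im - 1 / 2| ≤ 1 / 4 := by
    rw [← Int.self_sub_floor, ← Int.self_sub_floor, hr, hi, sub_sub, sub_sub]; exact h
  rw [blkUnit, if_pos ht, hr, hi]

/-! ### The three facts at unit mesh -/

/-- **Block radius** (unit mesh): every point is within `3/5` of the centre of its block (the
diamond has circumradius `1/4`, the octagon `√5/4 < 3/5`). [folklore] -/
theorem dist_zGs_blkUnit_le (w : ℂ) : dist w (zGs (blkUnit w)) ≤ 3 / 5 := by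
  have key : ∀ c : ℂ, (w.re - c.re) ^ 2 + (w.im - c.im) ^ 2 ≤ (3 / 5) ^ 2 → dist w c ≤ 3 / 5 := by
    intro c hc
    rw [← pow_le_pow_iff_left₀ dist_nonneg (by norm_num) two_ne_zero, Complex.dist_eq, Complex.sq_norm,
      Complex.normSq_apply, Complex.sub_re, Complex.sub_im]
    nlinarith [hc]
  unfold blkUnit
  split_ifs with h
  · apply key
    rw [zGs_re_inr, zGs_im_inr, ← sub_sub, ← sub_sub, Int.self_sub_floor, Int.self_sub_floor,
      ← sq_abs (Int.fract w.re - _), ← sq_abs (Int.fract w.im - _)]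
    have ha := abs_nonneg (Int.fract w.re - 1 / 2)
    have hb := abs_nonneg (Int.fract w.im - 1 / 2)
    nlinarith
  · apply key
    rw [not_le, abs_fract_sub_half, abs_fract_sub_half] at h
    rw [zGs_re_inl, zGs_im_inl, ← sq_abs (w.re - _), ← sq_abs (w.im - _)]
    have ha := abs_sub_round w.re
    have hb := abs_sub_round w.im
    have ha0 := abs_nonneg (w.re - round w.re)
    have hb0 := abs_nonneg (w.im - round w.im)
    nlinarith [mul_nonneg ha0 (sub_nonneg.2 ha), mul_nonneg hb0 (sub_nonneg.2 hb),
      mul_nonneg (sub_nonneg.2 ha) (sub_nonneg.2 hb),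
      mul_nonneg (add_nonneg ha0 hb0) (le_of_lt (sub_pos.2 h))]

/-- **Separation** (unit mesh): two points at distance `≤ 1/4` lie in equal or `G_s`-adjacent
blocks (two diamonds are `≥ 1/2` apart; a point within `1/4` of a diamond rounds to a corner of
its face; two octagons meeting only at a vertex are separated there by a diamond). [folklore] -/
theorem blkUnit_eq_or_adj {w w' : ℂ} (h : dist w w' ≤ 1 / 4) :
    blkUnit w = blkUnit w' ∨ Gs.Adj (blkUnit w) (blkUnit w') := by
  rw [Complex.dist_eq] at h
  have hx : |w.re - w'.re| ≤ 1 / 4 := by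
    have := Complex.abs_re_le_norm (w - w'); rw [Complex.sub_re] at this; linarith
  have hy : |w.im - w'.im| ≤ 1 / 4 := by
    have := Complex.abs_im_le_norm (w - w'); rw [Complex.sub_im] at this; linarith
  have n1 := abs_nonneg (Int.fract w.re - 1 / 2)
  have n2 := abs_nonneg (Int.fract w.im - 1 / 2)
  have n3 := abs_nonneg (Int.fract w'.re - 1 / 2)
  have n4 := abs_nonneg (Int.fract w'.im - 1 / 2)
  unfold blkUnit
  split_ifs with h1 h2 h2
  · left
    rw [floor_eq_floor_of_abs_sub_le hx (by linarith) (by linarith),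
      floor_eq_floor_of_abs_sub_le hy (by linarith) (by linarith)]
  · right
    rw [abs_sub_comm] at hx hy
    exact (Gs_adj_inl_inr_iff.2 ⟨round_sub_floor_of_abs_sub_le hx (by linarith),
      round_sub_floor_of_abs_sub_le hy (by linarith)⟩).symm
  · right
    exact Gs_adj_inl_inr_iff.2 ⟨round_sub_floor_of_abs_sub_le hx (by linarith),
      round_sub_floor_of_abs_sub_le hy (by linarith)⟩
  · rw [not_le, abs_fract_sub_half, abs_fract_sub_half] at h1 h2
    have i1 : |((round w.re : ℤ) : ℝ) - round w'.re| ≤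
        1 / 4 + |w.re - round w.re| + |w'.re - round w'.re| := by
      have e : ((round w.re : ℤ) : ℝ) - round w'.re =
          (w.re - w'.re) - (w.re - round w.re) + (w'.re - round w'.re) := by ring
      rw [e]
      have := abs_sub (w.re - w'.re) (w.re - round w.re)
      linarith [abs_add_le ((w.re - w'.re) - (w.re - round w.re)) (w'.re - round w'.re)]
    have i2 : |((round w.im : ℤ) : ℝ) - round w'.im| ≤
        1 / 4 + |w.im - round w.im| + |w'.im - round w'.im| := by
      have e : ((round w.im : ℤ) : ℝ) - round w'.im =
          (w.im - w'.im) - (w.im - round w.im) + (w'.im - round w'.im) := by ring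
      rw [e]
      have := abs_sub (w.im - w'.im) (w.im - round w.im)
      linarith [abs_add_le ((w.im - w'.im) - (w.im - round w.im)) (w'.im - round w'.im)]
    rcases int_eq_zero_or_sq_add_sq_eq_one (d := round w.re - round w'.re)
      (e := round w.im - round w'.im) (by push_cast; linarith) with ⟨hd, he⟩ | hsq
    · left; rw [sub_eq_zero.1 hd, sub_eq_zero.1 he]
    · right; exact Gs_adj_inl_inl_iff.2 hsq

/-- Spine, corner–corner edge: the segment between two adjacent lattice points stays in their two
octagons. [folklore] -/
theorem blkUnit_convexComb_inl_inl {p q : ℤ × ℤ} (hpq : (p.1 - q.1) ^ 2 + (p.2 - q.2) ^ 2 = 1)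
    {a b : ℝ} (ha : 0 ≤ a) (hb : 0 ≤ b) (hab : a + b = 1) :
    blkUnit (a • zGs (Sum.inl p) + b • zGs (Sum.inl q)) = Sum.inl p ∨
      blkUnit (a • zGs (Sum.inl p) + b • zGs (Sum.inl q)) = Sum.inl q := by
  obtain rfl : a = 1 - b := by linarith
  set w := (1 - b) • zGs (Sum.inl p) + b • zGs (Sum.inl q) with hw
  have hX : w.re = (1 - b) * p.1 + b * q.1 := by simp [hw]
  have hY : w.im = (1 - b) * p.2 + b * q.2 := by simp [hw]
  have h1 : |p.1 - q.1| ≤ 1 := (sq_le_one_iff_abs_le_one _).1 (by linarith [sq_nonneg (p.2 - q.2)])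
  have h2 : |p.2 - q.2| ≤ 1 := (sq_le_one_iff_abs_le_one _).1 (by linarith [sq_nonneg (p.1 - q.1)])
  have hc : p.1 = q.1 ∨ p.2 = q.2 := by
    refine (eq_or_ne p.1 q.1).imp_right fun hne => ?_
    by_contra hne'
    have e1 := (one_le_sq_iff_one_le_abs _).2 (Int.one_le_abs (sub_ne_zero.2 hne))
    have e2 := (one_le_sq_iff_one_le_abs _).2 (Int.one_le_abs (sub_ne_zero.2 hne'))
    linarith
  rcases hc with hc | hc
  · have hX' : w.re = p.1 := by rw [hX, hc]; ring
    have ht : ¬ (|Int.fract w.re - 1 / 2| + |Int.fract w.im - 1 / 2| ≤ 1 / 4) := by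
      rw [hX', Int.fract_intCast]
      have := abs_nonneg (Int.fract w.im - 1 / 2)
      norm_num [abs_of_neg]; linarith
    rw [blkUnit, if_neg ht, hX', round_intCast, hY]
    rcases round_convexComb h2 hb (by linarith) with hr | hr
    · left; rw [hr]
    · right; rw [hr, hc]
  · have hY' : w.im = p.2 := by rw [hY, hc]; ring
    have ht : ¬ (|Int.fract w.re - 1 / 2| + |Int.fract w.im - 1 / 2| ≤ 1 / 4) := by
      rw [hY', Int.fract_intCast]
      have := abs_nonneg (Int.fract w.re - 1 / 2)
      norm_num [abs_of_neg]; linarith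
    rw [blkUnit, if_neg ht, hY', round_intCast, hX]
    rcases round_convexComb h1 hb (by linarith) with hr | hr
    · left; rw [hr]
    · right; rw [hr, hc]

/-- Spine, corner–centre edge: the segment from a lattice point `p` to the centre of a face `f`
having `p` as a corner stays in the octagon of `p` (parameter `< 3/4`) and the diamond of `f`
(parameter `≥ 3/4`). [folklore] -/
theorem blkUnit_convexComb_inl_inr {p f : ℤ × ℤ}
    (hpf : (p.1 - f.1 = 0 ∨ p.1 - f.1 = 1) ∧ (p.2 - f.2 = 0 ∨ p.2 - f.2 = 1))
    {a b : ℝ} (ha : 0 ≤ a) (hb : 0 ≤ b) (hab : a + b = 1) :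
    blkUnit (a • zGs (Sum.inl p) + b • zGs (Sum.inr f)) = Sum.inl p ∨
      blkUnit (a • zGs (Sum.inl p) + b • zGs (Sum.inr f)) = Sum.inr f := by
  obtain rfl : a = 1 - b := by linarith
  set w := (1 - b) • zGs (Sum.inl p) + b • zGs (Sum.inr f) with hw
  have hX : w.re = p.1 + b * ((f.1 : ℝ) + 1 / 2 - p.1) := by simp [hw]; ring
  have hY : w.im = p.2 + b * ((f.2 : ℝ) + 1 / 2 - p.2) := by simp [hw]; ring
  have hσ : |(f.1 : ℝ) + 1 / 2 - p.1| = 1 / 2 := by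
    rcases hpf.1 with h | h
    · rw [show (p.1 : ℝ) = f.1 by exact_mod_cast sub_eq_zero.1 h]; norm_num
    · rw [show (p.1 : ℝ) = f.1 + 1 by exact_mod_cast (by omega : p.1 = f.1 + 1)]; norm_num [abs_of_neg]
  have hτ : |(f.2 : ℝ) + 1 / 2 - p.2| = 1 / 2 := by
    rcases hpf.2 with h | h
    · rw [show (p.2 : ℝ) = f.2 by exact_mod_cast sub_eq_zero.1 h]; norm_num
    · rw [show (p.2 : ℝ) = f.2 + 1 by exact_mod_cast (by omega : p.2 = f.2 + 1)]; norm_num [abs_of_neg]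
  have e1 : |w.re - p.1| = b * (1 / 2) := by
    rw [hX, add_sub_cancel_left, abs_mul, abs_of_nonneg hb, hσ]
  have e2 : |w.im - p.2| = b * (1 / 2) := by
    rw [hY, add_sub_cancel_left, abs_mul, abs_of_nonneg hb, hτ]
  rcases lt_or_ge b (3 / 4) with hb34 | hb34
  · left
    apply blkUnit_eq_inl_of <;> [rw [e1]; rw [e2]; rw [e1, e2]] <;> linarith
  · right
    apply blkUnit_eq_inr_of
    have e3 : w.re - (f.1 + 1 / 2) = -((1 - b) * ((f.1 : ℝ) + 1 / 2 - p.1)) := by rw [hX]; ring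
    have e4 : w.im - (f.2 + 1 / 2) = -((1 - b) * ((f.2 : ℝ) + 1 / 2 - p.2)) := by rw [hY]; ring
    rw [e3, e4, abs_neg, abs_neg, abs_mul, abs_mul, abs_of_nonneg (by linarith : (0 : ℝ) ≤ 1 - b),
      hσ, hτ]
    linarith

/-- **Spine** (unit mesh): the segment between the centres of two equal or `G_s`-adjacent blocks
stays inside these two blocks. [folklore] -/
theorem blkUnit_convexComb {u v : (ℤ × ℤ) ⊕ (ℤ × ℤ)} (huv : u = v ∨ Gs.Adj u v)
    {a b : ℝ} (ha : 0 ≤ a) (hb : 0 ≤ b) (hab : a + b = 1) :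
    blkUnit (a • zGs u + b • zGs v) = u ∨ blkUnit (a • zGs u + b • zGs v) = v := by
  rcases huv with rfl | huv
  · left; rw [← add_smul, hab, one_smul, blkUnit_zGs]
  rcases u with p | f <;> rcases v with q | g
  · exact blkUnit_convexComb_inl_inl (Gs_adj_inl_inl_iff.1 huv) ha hb hab
  · exact blkUnit_convexComb_inl_inr (Gs_adj_inl_inr_iff.1 huv) ha hb hab
  · have h :=
      blkUnit_convexComb_inl_inr (Gs_adj_inl_inr_iff.1 huv.symm) hb ha ((add_comm b a).trans hab)
    rw [add_comm (b • zGs (Sum.inl q))] at h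
    exact h.symm
  · exact absurd huv (not_Gs_adj_inr_inr f g)

/-! ### The registered sub-goal: the three facts at mesh `δ` -/

/-- **Registered sub-goal `stub_tiling`** (geometry of the cut-corner `4.8.8` block partition at
mesh `δ > 0`, block map `p ↦ blkUnit (p / δ)`): (RAD) every point is within `3δ/5` of the centre
`δ · zGs` of its block; (SEP) two points at distance `≤ δ/4` lie in equal or `G_s`-adjacent
blocks; (SPINE) the segment between the centres of two equal or adjacent blocks stays inside
these two blocks.  Reduction to unit mesh by `p = δ · (p / δ)`. [folklore] -/
theorem stub_tiling : ∀ {δ : ℝ}, 0 < δ →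
    (∀ p : ℂ, dist p ((δ : ℂ) * zGs (blkUnit (p / (δ : ℂ)))) ≤ 3 / 5 * δ) ∧
    (∀ p q : ℂ, dist p q ≤ δ / 4 →
      blkUnit (p / (δ : ℂ)) = blkUnit (q / (δ : ℂ)) ∨ Gs.Adj (blkUnit (p / (δ : ℂ))) (blkUnit (q / (δ : ℂ)))) ∧
    (∀ u v : (ℤ × ℤ) ⊕ (ℤ × ℤ), u = v ∨ Gs.Adj u v →
      ∀ z ∈ segment ℝ ((δ : ℂ) * zGs u) ((δ : ℂ) * zGs v), blkUnit (z / (δ : ℂ)) = u ∨ blkUnit (z / (δ : ℂ)) = v) := by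
  intro δ hδ
  have hδ0 : (δ : ℂ) ≠ 0 := Complex.ofReal_ne_zero.mpr hδ.ne'
  refine ⟨fun p => ?_, fun p q hpq => ?_, fun u v huv z hz => ?_⟩
  · calc dist p ((δ : ℂ) * zGs (blkUnit (p / (δ : ℂ))))
        = dist ((δ : ℂ) * (p / (δ : ℂ))) ((δ : ℂ) * zGs (blkUnit (p / (δ : ℂ)))) := by
          rw [mul_div_cancel₀ _ hδ0]
      _ = δ * dist (p / (δ : ℂ)) (zGs (blkUnit (p / (δ : ℂ)))) := by rw [dist_mul_zGs, abs_of_pos hδ]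
      _ ≤ δ * (3 / 5) := mul_le_mul_of_nonneg_left (dist_zGs_blkUnit_le _) hδ.le
      _ = 3 / 5 * δ := mul_comm _ _
  · apply blkUnit_eq_or_adj
    rw [Complex.dist_eq, ← sub_div, norm_div, Complex.norm_real, Real.norm_eq_abs, abs_of_pos hδ,
      div_le_iff₀ hδ, ← Complex.dist_eq]
    linarith
  · obtain ⟨a, b, ha, hb, hab, rfl⟩ := hz
    have e : (a • ((δ : ℂ) * zGs u) + b • ((δ : ℂ) * zGs v)) / (δ : ℂ) = a • zGs u + b • zGs v := by
      simp only [Complex.real_smul]; field_simp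
    rw [e]
    exact blkUnit_convexComb huv ha hb hab

end Summit.CriticalPhenomena.CardyFormulaZ2.Cruxes.SquareFromVoronoiHub.PoissonisedChessboard

end
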